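import Literature.AlgebraicGeometry.Resolution.AlterationsSemiStable
import Literature.AlgebraicGeometry.Resolution.AlterationsSemiStableCodimTwo
import Literature.AlgebraicGeometry.Resolution.AlterationsSemiStableThickness
import Literature.AlgebraicGeometry.Resolution.AlterationsSemiStableThicknessHolds
import Literature.AlgebraicGeometry.Resolution.NodalDeformation
import Literature.AlgebraicGeometry.Resolution.NodeFittingTrace
import Summits.ResolutionOfSingularities.ResolutionOfSingularities.Theorems.WildQuotientsSummitReductionStubPairSsCodimThreeCodimTwo
import HarnessLib

/-!
# `WildQuotients.SummitReduction` (stmt-ResolutionOfSingularities-16324), line `FramePerfect`, skeleton v7: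
# stub `stub_pair_nodeThickness` (de Jong 1996, 3.3–3.4: 2 ≤ n(x) < ∞ at codimension-2 singular points (quasi-split, any field))

Route `ResolutionOfSingularities/WildQuotients`, crux `SummitReduction`; registered stub of the line skeleton
`Cruxes/SummitReduction/Lines/FramePerfect.lean` (v7, lead c4). Worker file.

De Jong 1996, 3.4 ¶2 (p. 63): "The integer `n₁` must be `≥ 2`, otherwise `X` is regular along the
generic point of `T` … it is an invariant `n_T` of the codimension 2 irreducible component `T` of
`Sing(X)`", for the curve `f : X ⟶ Y` of a QUASI-SPLIT semi-stable pair over an ARBITRARY field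
(`Y` regular integral projective, `D ⊆ Y` a strict normal crossings divisor, `f` semi-stable and
smooth over `Y ∖ D`), at a non-regular point `x` with `dim 𝒪_{X,x} ≤ 2` — `x` need not be closed
and the residue fields need not be algebraically closed. The tree proves the statement for pairs
in Situation 4.23 over an algebraically closed field (`DeJong1996SemiStableThickness_holds`); its
assembly (`DeJong1996SemiStableThickness.of_singFitting`) is general but for ONE input, the
two-generation of the stalk `Fitt₁(Ω_{X/Y})_x` of the ideal of `Sing(f)` (2.23, Remark), which the
tree obtains at closed points over `k = k̄`. Here that input is derived directly at `x` from the
quasi-split datum `(𝒪_{X,x}/𝔪_y 𝒪_{X,x})^ ≅ κ(y)⟦u, v⟧/(uv)` over `κ(y)`: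

* `exists_sub_mem_maximalIdeal_of_quasiSplit` — the datum forces `κ(y) = κ(x)`: every germ at
  `x` is a germ at `y = f x` plus an element of `𝔪_x` (compose with the constant coefficient
  `κ(y)⟦u, v⟧/(uv) → κ(y)`);
* `exists_fittingIdeal_eq_span_pair_of_quasiSplit` — **2.23 with its Remark at `x`**: Liu 2002,
  Lemma 10.3.20 in the tree's pre-completion form (`NodalDeformation.exists_ringEquiv_cpl`:
  `𝒪̂_{X,x} ≅ 𝒪̂_{Y,y}⟦u, v⟧/(uv - h)` for the FLAT local homomorphism `𝒪_{Y,y} → 𝒪_{X,x}` with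
  equal residue fields and formal-node closed fibre), the Remark of 2.23
  (`DeJong1996.NodeDeformationRing.map_fittingIdeal_eq_span`: `Fitt₁ · 𝒪̂_{X,x} ↦ (u, v)`), and
  descent of two generators from the completion (`Ideal.exists_eq_span_pair_of_map_adicCompletion`);
* `notMem_of_isField_stalk_of_sncd`, `ringKrullDim_base_le_one_of_codimLE` — the two remaining
  Situation-4.23 lemmas of the assembly in the binder conventions of the line;
* `stub_pair_nodeThickness` — the assembly `DeJong1996SemiStableThickness.of_singFitting` re-run
  verbatim with these inputs (`I ≠ B` by Stacks 01V9 and 3.1; `𝔪_B ⊄ I` as `I` is two-generated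
  while `dim B = 2` and `B` is not regular; every prime over `I` is `𝔪_B` by 2.21 and smoothness
  over `Y ∖ D`).
-/

set_option linter.dupNamespace false

noncomputable section

open CategoryTheory CategoryTheory.Limits AlgebraicGeometry TopologicalSpace
open Literature.AlgebraicGeometry.Resolution
open Literature.AlgebraicGeometry
open IsLocalRing NodalDeformation Order

namespace Summit.ResolutionOfSingularities.ResolutionOfSingularities.Theorems

universe u

/-! ## The quasi-split datum forces equal residue fields -/

/-- **A quasi-split node has residue field `κ(y)`.** Let `ρ : A → B` be a homomorphism of local
rings and suppose the completion of the closed fibre `B/𝔪_A B` (at the image of `𝔪_B`) is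
identified with the formal node `κ(A)⟦u, v⟧/(uv)` compatibly with the `κ(A)`-algebra structures
(de Jong 1996, 2.23: the split/quasi-split case "`k(x) = k'`"). Then every `b ∈ B` is `ρ(a) + m`
with `a ∈ A`, `m ∈ 𝔪_B`: compose `B → B/𝔪_A B → (B/𝔪_A B)^ ≅ κ(A)⟦u, v⟧/(uv)` with the constant
coefficient `κ(A)⟦u, v⟧/(uv) → κ(A)` to get a ring homomorphism `φ : B → κ(A)` with
`φ ∘ ρ = (A → κ(A))`; if `φ(b) = φ(ρ a)` then `b - ρ a` is not a unit.
[cite: DeJong1996, 2.23, pp. 61–62] -/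
theorem exists_sub_mem_maximalIdeal_of_quasiSplit {A B : Type u} [CommRing A] [CommRing B]
    [IsLocalRing A] [IsLocalRing B] (ρ : A →+* B)
    (e : AdicCompletion ((maximalIdeal B).map (Ideal.Quotient.mk ((maximalIdeal A).map ρ)))
        (B ⧸ (maximalIdeal A).map ρ) ≃+*
      MvPowerSeries (Fin 2) (A ⧸ maximalIdeal A) ⧸
        Ideal.span {(MvPowerSeries.X 0 * MvPowerSeries.X 1 :
          MvPowerSeries (Fin 2) (A ⧸ maximalIdeal A))})
    (he : e.toRingHom.comp ((algebraMap (B ⧸ (maximalIdeal A).map ρ) _).comp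
        (Ideal.quotientMap ((maximalIdeal A).map ρ) ρ Ideal.le_comap_map)) =
      algebraMap (A ⧸ maximalIdeal A) _)
    (b : B) : ∃ a : A, b - ρ a ∈ maximalIdeal B := by
  -- the constant coefficient `cc : κ⟦u, v⟧/(uv) → κ`
  have hcc : ∀ p ∈ Ideal.span {(MvPowerSeries.X 0 * MvPowerSeries.X 1 :
      MvPowerSeries (Fin 2) (A ⧸ maximalIdeal A))}, MvPowerSeries.constantCoeff p = 0 := by
    intro p hp
    obtain ⟨c, rfl⟩ := Ideal.mem_span_singleton'.mp hp
    rw [map_mul, map_mul, MvPowerSeries.constantCoeff_X, zero_mul, mul_zero]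
  let cc : (MvPowerSeries (Fin 2) (A ⧸ maximalIdeal A) ⧸
      Ideal.span {(MvPowerSeries.X 0 * MvPowerSeries.X 1 :
        MvPowerSeries (Fin 2) (A ⧸ maximalIdeal A))}) →+* A ⧸ maximalIdeal A :=
    Ideal.Quotient.lift _ MvPowerSeries.constantCoeff hcc
  -- `φ : B → κ(A)` with `φ ∘ ρ = (A → κ(A))`
  let φ : B →+* A ⧸ maximalIdeal A :=
    cc.comp (e.toRingHom.comp ((algebraMap (B ⧸ (maximalIdeal A).map ρ) _).comp
      (Ideal.Quotient.mk ((maximalIdeal A).map ρ))))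
  have hφ : ∀ a : A, φ (ρ a) = Ideal.Quotient.mk (maximalIdeal A) a := by
    intro a
    have h1 := DFunLike.congr_fun he (Ideal.Quotient.mk (maximalIdeal A) a)
    simp only [RingHom.comp_apply, Ideal.quotientMap_mk] at h1
    simp only [φ, RingHom.comp_apply]
    rw [h1, ← Ideal.Quotient.mk_algebraMap, MvPowerSeries.algebraMap_apply,
      Algebra.algebraMap_self_apply, Ideal.Quotient.lift_mk, MvPowerSeries.constantCoeff_C]
  obtain ⟨a, ha⟩ := Ideal.Quotient.mk_surjective (φ b)
  refine ⟨a, ?_⟩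
  rw [mem_maximalIdeal, mem_nonunits_iff]
  intro hu
  have h2 : φ (b - ρ a) = 0 := by rw [map_sub, hφ, ha, sub_self]
  haveI : Nontrivial (A ⧸ maximalIdeal A) :=
    Ideal.Quotient.nontrivial_iff.mpr (maximalIdeal.isMaximal A).ne_top
  exact (hu.map φ).ne_zero h2

/-! ## 2.23 with its Remark at a quasi-split point: `Fitt₁(Ω_{B/A})` is two-generated -/

/-- **de Jong 1996, 2.23 with its Remark, at a quasi-split point of `Sing(f)` — `Fitt₁(Ω_{B/A})`
is generated by two elements.** Let `A → B` be a FLAT local homomorphism of Noetherian local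
rings, essentially of finite type, whose closed fibre `B/𝔪_A B` has completion the formal node
`κ(A)⟦u, v⟧/(uv)` over `κ(A)` (the quasi-split datum). Then `Fitt₁(Ω_{B/A}) = (a, b)` for some
`a, b`: the residue fields agree (`exists_sub_mem_maximalIdeal_of_quasiSplit`), so Liu 2002,
Lemma 10.3.20 (`NodalDeformation.exists_ringEquiv_cpl`) gives `B̂ ≅ Â⟦u, v⟧/(uv - h)` over `Â`
("The complete local ring of `X` at `x` is `B ≅ A⟦u, v⟧/(uv - h)` for some `h ∈ A`", 2.23); the
Remark of 2.23 ("the trace of `Sing(f)` on the scheme `Spec B` is given by the ideal `(u, v) ⊂ B`",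
`DeJong1996.NodeDeformationRing.map_fittingIdeal_eq_span`) identifies `Fitt₁ · B̂` with `(u, v)`;
and two generators descend from the completion (`Ideal.exists_eq_span_pair_of_map_adicCompletion`).
[cite: DeJong1996, 2.23 with Remark, pp. 61–62] -/
theorem exists_fittingIdeal_eq_span_pair_of_quasiSplit {A B : Type u} [CommRing A] [CommRing B]
    [IsLocalRing A] [IsLocalRing B] [IsNoetherianRing A] [IsNoetherianRing B] [Algebra A B]
    [IsLocalHom (algebraMap A B)] [Algebra.EssFiniteType A B] (hflat : (algebraMap A B).Flat)
    (e : AdicCompletion ((maximalIdeal B).map (Ideal.Quotient.mk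
          ((maximalIdeal A).map (algebraMap A B)))) (B ⧸ (maximalIdeal A).map (algebraMap A B)) ≃+*
      MvPowerSeries (Fin 2) (A ⧸ maximalIdeal A) ⧸
        Ideal.span {(MvPowerSeries.X 0 * MvPowerSeries.X 1 :
          MvPowerSeries (Fin 2) (A ⧸ maximalIdeal A))})
    (he : e.toRingHom.comp ((algebraMap (B ⧸ (maximalIdeal A).map (algebraMap A B)) _).comp
        (Ideal.quotientMap ((maximalIdeal A).map (algebraMap A B)) (algebraMap A B)
          Ideal.le_comap_map)) =
      algebraMap (A ⧸ maximalIdeal A) _) :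
    ∃ a b : B, Literature.RingTheory.FittingIdeal.Module.fittingIdeal B Ω[B⁄A] 1 =
      Ideal.span {a, b} := by
  have hres' := exists_sub_mem_maximalIdeal_of_quasiSplit (algebraMap A B) e he
  have hres : Function.Surjective ((residue B).comp (algebraMap A B)) := by
    intro r
    obtain ⟨b, rfl⟩ := residue_surjective r
    obtain ⟨a, ha⟩ := hres' b
    refine ⟨a, ?_⟩
    rw [RingHom.comp_apply]
    show Ideal.Quotient.mk _ _ = Ideal.Quotient.mk _ _
    rw [Ideal.Quotient.mk_eq_mk_iff_sub_mem, ← neg_sub]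
    exact Submodule.neg_mem _ ha
  -- 2.23 (Liu 10.3.20): `e' : Â⟦u, v⟧/(uv - h) ≅ B̂` over `Â → B̂`
  obtain ⟨h, e', -, hC⟩ := NodalDeformation.exists_ringEquiv_cpl (algebraMap A B) hres hflat e
  have hΨ : ∀ a : A, e'.symm (algebraMap B (Cpl B) (algebraMap A B a)) =
      Ideal.Quotient.mk _ (MvPowerSeries.C (algebraMap A (Cpl A) a)) := by
    intro a
    apply e'.injective
    rw [RingEquiv.apply_symm_apply, hC, NodalDeformation.complMap_algebraMap]
  -- the Remark of 2.23: `Fitt₁ · B̂ ↦ (u, v)` under `e'.symm`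
  have htr := DeJong1996.NodeDeformationRing.map_fittingIdeal_eq_span hres' e'.symm hΨ
  have hgen : (Literature.RingTheory.FittingIdeal.Module.fittingIdeal B Ω[B⁄A] 1).map
      (algebraMap B (Cpl B)) =
      Ideal.span {e' (Ideal.Quotient.mk _ (MvPowerSeries.X 0)),
        e' (Ideal.Quotient.mk _ (MvPowerSeries.X 1))} := by
    have h1 := congrArg (Ideal.map e'.toRingHom) htr
    rw [Ideal.map_map, RingEquiv.toRingHom_comp_symm_toRingHom, Ideal.map_id, Ideal.map_span,
      RingEquiv.toRingHom_eq_coe, RingHom.coe_coe, Set.image_pair] at h1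
    exact h1
  obtain ⟨a, b, -, -, hab⟩ :=
    Literature.AlgebraicGeometry.Resolution.Ideal.exists_eq_span_pair_of_map_adicCompletion
      (Literature.RingTheory.FittingIdeal.Module.fittingIdeal B Ω[B⁄A] 1) hgen
  exact ⟨a, b, hab⟩

/-! ## Two Situation-4.23 lemmas of the assembly, in the binder conventions of the line -/

/-- A point of `Y` whose local ring is a field is off a strict normal crossings divisor `D` (the
local rings of `Y` along `D` have dimension `r + e ≥ 1`). [folklore] -/
theorem notMem_of_isField_stalk_of_sncd {Y : Scheme.{0}} {D : Set Y}
    (hD : IsStrictNormalCrossingsDivisor Y D) {y : Y} (hy : IsField (Y.presheaf.stalk y)) :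
    y ∉ D := by
  intro hyD
  obtain ⟨r, e, -, -, hr, hdim, -, -⟩ := hD.exists_regularSystemOfParameters hyD
  rw [ringKrullDim_eq_zero_of_isField hy] at hdim
  have : (0 : WithBot ℕ∞) ≠ ((r + e : ℕ) : WithBot ℕ∞) := by
    have hne : (0 : ℕ) ≠ r + e := by omega
    exact_mod_cast hne
  exact this hdim

/-- For a flat morphism `f : X ⟶ Y` of locally Noetherian schemes, locally of finite type, with
reduced fibre `X_{f x}` and regular `𝒪_{Y, f x}`: at a non-regular point `x` with `dim 𝒪_{X,x} ≤ 2`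
the base local ring `𝒪_{Y, f x}` has dimension `≤ 1` (it is `dim 𝒪_{X,x} - dim 𝒪_{X_{f x}, x}` by
flatness, EGA IV₂ 6.1.2, and the fibre local ring has positive dimension, else `x` would be
regular, Matsumura 23.7 (ii)). [folklore] -/
theorem ringKrullDim_base_le_one_of_codimLE {X Y : Scheme.{0}} (f : X ⟶ Y) [Flat f]
    [LocallyOfFiniteType f] [IsLocallyNoetherian X] [IsLocallyNoetherian Y] {x : X}
    (hred : IsReduced (f.fiber (f x))) (hregy : IsRegularLocalRing (Y.presheaf.stalk (f x)))
    (hx : x ∈ Scheme.singularLocusCodimLE X 2) :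
    ringKrullDim (Y.presheaf.stalk (f x)) ≤ 1 := by
  haveI : LocallyOfFiniteType (f.fiberToSpecResidueField (f x)) :=
    MorphismProperty.pullback_snd _ _ inferInstance
  haveI : IsLocallyNoetherian (f.fiber (f x)) :=
    LocallyOfFiniteType.isLocallyNoetherian (f.fiberToSpecResidueField (f x))
  have hR1 : (1 : WithBot ℕ∞) ≤ ringKrullDim ((f.fiber (f x)).presheaf.stalk (f.asFiber x)) := by
    by_contra hlt
    have hle := ringKrullDim_le_zero_of_not_one_le
      ((f.fiber (f x)).presheaf.stalk (f.asFiber x)) hlt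
    haveI : Ring.KrullDimLE 0 ((f.fiber (f x)).presheaf.stalk (f.asFiber x)) :=
      Ring.krullDimLE_iff.mpr hle
    have hF : IsField ((f.fiber (f x)).presheaf.stalk (f.asFiber x)) :=
      Ring.KrullDimLE.isField_of_isReduced
    exact hx.1 (isRegularLocalRing_stalk_of_isField_stalk_fiber f x hregy hF)
  -- EGA IV₂ 6.1.2
  have h3 := Literature.AlgebraicGeometry.Motives.coheight_eq_coheight_add_ringKrullDim_stalk_fiber f x
  have h2 : (coheight x : WithBot ℕ∞) ≤ 2 := by
    rw [← ringKrullDim_stalk_eq_coheight]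
    exact hx.2
  obtain ⟨a, ha⟩ := exists_ringKrullDim_eq_natCast (Y.presheaf.stalk (f x))
  obtain ⟨c, hc⟩ := exists_ringKrullDim_eq_natCast ((f.fiber (f x)).presheaf.stalk (f.asFiber x))
  rw [ringKrullDim_stalk_eq_coheight] at ha
  rw [ha, hc] at h3
  rw [h3] at h2
  rw [hc] at hR1
  rw [ringKrullDim_stalk_eq_coheight, ha]
  have h1c : 1 ≤ c := by exact_mod_cast hR1
  have hac : a + c ≤ 2 := by exact_mod_cast h2
  exact_mod_cast (show a ≤ 1 by omega)

/-! ## The stub -/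

/-- **de Jong 1996, 3.4: `2 ≤ n_T < ∞` for the quasi-split `G`-semi-stable pairs of the line,
over an arbitrary field** (stub `stub_pair_nodeThickness` of line `FramePerfect`). For `Y`
regular integral projective over `k`, `D ⊆ Y` a strict normal crossings divisor, `X` integral
projective over `k`, `f : X ⟶ Y` a quasi-split semi-stable curve smooth over `Y ∖ D`, and a
non-regular point `x` with `dim 𝒪_{X,x} ≤ 2`: the length `n(x)` of `𝒪_{X,x}/Fitt₁(Ω_{X/Y})_x`
(`Scheme.Hom.nodeThickness`) is an integer `≥ 2`. "The integer `n₁` must be `≥ 2`, otherwise `X`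
is regular along the generic point of `T`" (3.4). Proof: the assembly
`DeJong1996SemiStableThickness.of_singFitting` verbatim, with `B = 𝒪_{X,x}`, `A = 𝒪_{Y,f x}`,
`I = Fitt₁(Ω_{B/A})`, `dim B = 2` (`two_le_ringKrullDim_of_not_isRegularLocalRing`):
`I ≠ B` (else `Ω_{B/A}` is cyclic, `f` is smooth at `x` by Stacks 01V9, and `B` is regular, 3.1);
`𝔪_B ⊄ I`, since `I` is two-generated (`exists_fittingIdeal_eq_span_pair_of_quasiSplit`, from the
quasi-split datum at `x`) while `B` is not regular of dimension `2`; and every prime `Q ⊇ I` is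
`𝔪_B` (if `𝔪_A B ⊆ Q`, by 2.21 `Sing(f) → Y` unramified; if not, `Q` is the prime of a
generization over the generic point of the `≤ 1`-dimensional regular `A`, i.e. over `Y ∖ D`,
where `f` is smooth and `I ⊄ Q` by Stacks 07ZC). [cite: DeJong1996, 3.4, p. 63] -/
theorem stub_pair_nodeThickness (k : Type) [Field k] (Y : Scheme.{0}) [IsIntegral Y]
    (q : Y ⟶ Spec (.of k)) (_hprojY : Motives.IsProjectiveOver (Over.mk q))
    (hreg : Scheme.IsRegular Y) (D : Set Y)
    (hD : IsStrictNormalCrossingsDivisor Y D) (X : Scheme.{0}) [IsIntegral X] (f : X ⟶ Y)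
    (hprojX : Motives.IsProjectiveOver (Over.mk (f ≫ q))) (hss : IsSemiStableCurve f)
    (hqs : (∀ x : X, (¬ ∃ U : X.Opens, x ∈ U ∧ Smooth (U.ι ≫ f)) →
        ∃ e : AdicCompletion
            ((IsLocalRing.maximalIdeal (X.presheaf.stalk x)).map (Ideal.Quotient.mk
              ((IsLocalRing.maximalIdeal (Y.presheaf.stalk (f.base x))).map (f.stalkMap x).hom)))
            (X.presheaf.stalk x ⧸
              (IsLocalRing.maximalIdeal (Y.presheaf.stalk (f.base x))).map (f.stalkMap x).hom) ≃+*
          MvPowerSeries (Fin 2) (Y.presheaf.stalk (f.base x) ⧸ IsLocalRing.maximalIdeal (Y.presheaf.stalk (f.base x))) ⧸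
            Ideal.span {(MvPowerSeries.X 0 * MvPowerSeries.X 1 :
              MvPowerSeries (Fin 2) (Y.presheaf.stalk (f.base x) ⧸ IsLocalRing.maximalIdeal (Y.presheaf.stalk (f.base x))))},
          e.toRingHom.comp ((algebraMap (X.presheaf.stalk x ⧸
              (IsLocalRing.maximalIdeal (Y.presheaf.stalk (f.base x))).map (f.stalkMap x).hom) _).comp
            (Ideal.quotientMap ((IsLocalRing.maximalIdeal (Y.presheaf.stalk (f.base x))).map (f.stalkMap x).hom)
              (f.stalkMap x).hom Ideal.le_comap_map)) =
          algebraMap (Y.presheaf.stalk (f.base x) ⧸ IsLocalRing.maximalIdeal (Y.presheaf.stalk (f.base x))) _))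
    (hsm : Smooth (f ∣_ ⟨Dᶜ, hD.isClosed.isOpen_compl⟩))
    (x : X) (hx : x ∈ Scheme.singularLocusCodimLE X 2) :
    2 ≤ Scheme.Hom.nodeThickness f x ∧ Scheme.Hom.nodeThickness f x ≠ ⊤ := by
  haveI : IsNoetherian X := DeJong1996.isNoetherian_of_isProjectiveOver (f ≫ q) hprojX
  haveI : IsLocallyNoetherian Y := isLocallyNoetherian_base hss
  haveI : Flat f := hss.flat
  haveI := hss.locallyOfFiniteType
  have h1 := DeJong1996SingUnramified_holds.{0}
  have h2 := DeJong1996SmoothIffDifferentialsCyclic_holds.{0}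
  -- 3.1: the smooth locus consists of regular points
  have hsmreg : ∀ {x' : X} {U : X.Opens}, Smooth (U.ι ≫ f) → x' ∈ U →
      IsRegularLocalRing (X.presheaf.stalk x') := fun hU hxU =>
    isRegularLocalRing_of_smooth_of_isRegular hreg f hU hxU
  -- `f` is smooth over `Y ∖ D`
  have hsmD : ∀ {x' : X}, f x' ∉ D → ∃ U : X.Opens, x' ∈ U ∧ Smooth (U.ι ≫ f) := by
    intro x' hx'
    let V : Y.Opens := ⟨Dᶜ, hD.isClosed.isOpen_compl⟩
    haveI : Smooth (f ∣_ V) := hsm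
    refine ⟨f ⁻¹ᵁ V, hx', ?_⟩
    rw [← morphismRestrict_ι]
    infer_instance
  -- the local rings `A → B` and the ideal `I = Fitt₁(Ω_{B/A})`
  let A := Y.presheaf.stalk (f x)
  let B := X.presheaf.stalk x
  letI algAB : Algebra A B := (f.stalkMap x).hom.toAlgebra
  haveI : IsLocalHom (algebraMap A B) := inferInstanceAs (IsLocalHom (f.stalkMap x).hom)
  haveI : Algebra.EssFiniteType A B := by
    rw [← RingHom.essFiniteType_algebraMap, RingHom.algebraMap_toAlgebra]
    exact LocallyOfFiniteType.stalkMap f x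
  let I : Ideal B := Scheme.Hom.singFittingIdeal f x
  have hI : I = Literature.RingTheory.FittingIdeal.Module.fittingIdeal B (KaehlerDifferential A B) 1 :=
    rfl
  have hregx : ¬ IsRegularLocalRing B := hx.1
  have hdim2 : ringKrullDim B = 2 :=
    le_antisymm hx.2
      (two_le_ringKrullDim_of_not_isRegularLocalRing k f q hprojX hreg D hD hss hsm x hx.1)
  -- (1) `I ≠ B`
  have hItop : I ≠ ⊤ := by
    intro htop
    rw [hI] at htop
    obtain ⟨ω, hω⟩ :=
      (Literature.RingTheory.FittingIdeal.Module.fittingIdeal_one_eq_top_iff (R := B)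
        (M := KaehlerDifferential A B)).mp htop
    obtain ⟨U, hxU, hU⟩ := (h2 X Y f hss x).mpr ⟨ω, hω⟩
    exact hregx (hsmreg hU hxU)
  -- (2) `𝔪_B ⊄ I`: `I` is two-generated, from the quasi-split datum at `x`
  have hns : ¬ ∃ U : X.Opens, x ∈ U ∧ Smooth (U.ι ≫ f) := by
    rintro ⟨U, hxU, hU⟩
    exact hregx (hsmreg hU hxU)
  have hmI : ¬ maximalIdeal B ≤ I := by
    intro hle
    obtain ⟨e, he⟩ := hqs x hns
    obtain ⟨a, b, hab⟩ := exists_fittingIdeal_eq_span_pair_of_quasiSplit (A := A) (B := B)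
      (Flat.stalkMap f x) e he
    rw [← hI] at hab
    have hmeq : maximalIdeal B = Ideal.span {a, b} := by
      rw [← hab]
      exact le_antisymm hle (le_maximalIdeal hItop)
    apply hregx
    refine IsRegularLocalRing.of_spanFinrank_maximalIdeal_le B ?_
    rw [hdim2, hmeq]
    have hle2 : (Ideal.span {a, b}).spanFinrank ≤ ({a, b} : Set B).ncard :=
      Submodule.spanFinrank_span_le_ncard_of_finite (Set.toFinite _)
    have h2' : ({a, b} : Set B).ncard ≤ 2 := by
      calc ({a, b} : Set B).ncard ≤ ({b} : Set B).ncard + 1 := Set.ncard_insert_le a {b}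
        _ = 2 := by rw [Set.ncard_singleton]
    exact_mod_cast hle2.trans h2'
  -- (3) every prime over `I` is `𝔪_B`
  have hprime : ∀ Q : Ideal B, Q.IsPrime → I ≤ Q → Q = maximalIdeal B := by
    intro Q hQ hIQ
    by_cases hmA : (maximalIdeal A).map (algebraMap A B) ≤ Q
    · have h1x := (h1 X Y f hss x hItop).1
      exact le_antisymm (le_maximalIdeal hQ.ne_top) (h1x.trans (sup_le hIQ hmA))
    · exfalso
      -- the generization `x'` of `x` with prime `Q`, and its image `f x'`
      obtain ⟨x', hx', hQeq⟩ := exists_specializes_comap_stalkSpecializes_eq x Q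
      have hy' : f x' ⤳ f x := hx'.map f.continuous
      let A' := Y.presheaf.stalk (f x')
      let B' := X.presheaf.stalk x'
      letI algAA' : Algebra A A' := (Y.presheaf.stalkSpecializes hy').hom.toAlgebra
      let QA : Ideal A := (maximalIdeal A').comap (Y.presheaf.stalkSpecializes hy').hom
      haveI : IsLocalization.AtPrime A' QA := isLocalizationAtPrime_stalkSpecializes hy'
      -- `QA = Q ∩ A` is a prime of `A` other than `𝔪_A`
      have hQA : QA = Q.comap (algebraMap A B) := by
        rw [hQeq, Ideal.comap_comap]
        show (maximalIdeal A').comap (Y.presheaf.stalkSpecializes hy').hom =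
          (maximalIdeal B').comap ((X.presheaf.stalkSpecializes hx').hom.comp (f.stalkMap x).hom)
        rw [← IsLocalRing.maximalIdeal_comap (f.stalkMap x').hom, Ideal.comap_comap,
          ← CommRingCat.hom_comp, ← CommRingCat.hom_comp, Scheme.Hom.stalkSpecializes_stalkMap]
      have hQAne : QA ≠ maximalIdeal A := by
        intro heq
        apply hmA
        rw [Ideal.map_le_iff_le_comap, ← hQA, heq]
      -- `dim A ≤ 1` and `A` is a regular local ring, hence a domain: so `QA = ⊥`
      haveI : IsRegularLocalRing A := hreg (f x)
      haveI : IsDomain A := isDomain_of_isRegularLocalRing A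
      haveI : Ring.KrullDimLE 1 A := Ring.krullDimLE_iff.mpr
        (ringKrullDim_base_le_one_of_codimLE f (hss.isReduced_fiber (f x)) (hreg (f x)) hx)
      have hQAbot : QA = ⊥ := by
        by_contra hne
        exact hQAne (IsLocalRing.eq_maximalIdeal
          (Ideal.IsPrime.isMaximal_of_ne_bot (Ideal.IsPrime.comap _) hne))
      -- so `A' = 𝒪_{Y, f x'}` is a field and `f x' ∉ D`: `f` is smooth at `x'`
      have hA'field : IsField A' := by
        rw [IsLocalRing.isField_iff_maximalIdeal_eq]
        have := IsLocalization.map_under QA.primeCompl (S := A') (maximalIdeal A')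
        rw [Ideal.under, show (maximalIdeal A').comap (algebraMap A A') = QA from rfl, hQAbot,
          Ideal.map_bot] at this
        exact this.symm
      have hxD : f x' ∉ D := notMem_of_isField_stalk_of_sncd hD hA'field
      obtain ⟨U, hx'U, hU⟩ := hsmD hxD
      have hcyc := (h2 X Y f hss x').mp ⟨U, hx'U, hU⟩
      -- 07ZC along `B → B_Q = 𝒪_{X,x'}`: `I ⊄ Q`
      obtain ⟨d, hd, hdQ⟩ := exists_mem_fittingIdeal_notMem_of_specializes f hx' hcyc
      rw [← hQeq] at hdQ
      exact hdQ (hIQ (hI ▸ hd))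
  -- conclusion
  show (2 : ℕ∞) ≤ Module.length B (B ⧸ I) ∧ Module.length B (B ⧸ I) ≠ ⊤
  exact ⟨two_le_length_quotient I hItop hmI, length_quotient_ne_top_of_forall_isPrime I hprime⟩

end Summit.ResolutionOfSingularities.ResolutionOfSingularities.Theorems

end
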